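import Summits.AtomisticToContinuum.HydrodynamicLimit.Theorems.BoxDissipativeWeakStrongRelativeEnergyStabilityGronwallIntegrableAlong
import Summits.AtomisticToContinuum.HydrodynamicLimit.Theorems.BoxDissipativeWeakStrongRelativeEnergyStabilityGronwallPointwise
import Summits.AtomisticToContinuum.HydrodynamicLimit.Theorems.BoxDissipativeWeakStrongFluxClosureBoxIntegrableAlongFlow
import HarnessLib

/-!
# Crux `RelativeEnergyStability` (stmt-AtomisticToContinuum-17653), line `registered`, heart stub S-X —
# helper package A, part 2: the clamped box relative-energy observable along a good orbit (`sx_integrableOn_obs`)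

Under the strong-side conjunction `S` of `…GronwallStrong` (EOS fact data `(η₀, F)`, band `η₁ ≤ η₁B < η₀/2`, smooth
band extension `(χ, f)`, classical hard-sphere Euler solution `(ρ,u,θ)` on `[0,T)` with the guard `ρσ³ ≤ η₁/2`):
for a window `l > 0`, clamps `a ≤ b` and `t < T` there are constants `A, B` such that for every GOOD datum `z` of
the hard-sphere flow, `s ↦ e(s,z) = ∫ ℰ_{Z_{a,b}}(Û(Φ_s z)(x) | (ρ,u,θ)(s,x)) dx` (`clampedRelEnergyObs`) is
integrable on `(0,t]` and `|e(s,z)| ≤ A + B·E(z)` on `[0,t]` (`E` = kinetic energy, conserved on good orbits).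

Proof. POINTWISE: `|ℰ_Z| ≤ C(1 + |ρ̂| + ‖m̂‖ + |Ê|)` (`tz_abs_clampedRelEnergy_le`) with `C` from sup bounds on
`[0,t] × 𝕋³` of `‖u‖`, `|θ|`, `|μ_cut(ρ,θ)|`, `|p_cut(ρ,θ)|` — the latter two are the coefficients of the smooth
band extension along the solution (`sx_pd_transfer`, `IsClassicalEulerSolution.exists_coeffBound`); and
`|ρ̂| ≤ l⁻³`, `‖m̂‖ ≤ l⁻³(1 + 2E)`, `0 ≤ Ê ≤ 2E·l⁻³` (`EABirthS1a.abs_density_le`, `norm_momentum_le`,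
`FluxClosureB4.boxAtoms_bounds` with the speed bound `norm_vel_flow_le`). INTEGRABILITY IN TIME: measurable + bounded
(`ia_integrableOn_Ioc_integral`); joint measurability of `(s,x) ↦ ℰ_Z` at the time-clamped strong data (clamp
invisible on `(0,t]`) from the tested form `ℰ_Z = Ê − m̂·u + ρ̂φ₁ − θ ρ̂ Z_{a,b}(ŝ) + p_cut` (`sx_clampedRelEnergy_box`):
box fields (`LGFS.measurable_empirical*Field_param` along the measurable orbit `HardSphereFlow.measurable_flow_prod_torus`),
the clamped cut entropy (`EABirthS1a.measurable_statEntropy`), the strong fields and `φ₁` (`EABirthS1a.measurable_clampTime`,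
`sx_energyTest_smooth`), and `p_cut = ρθ Z(min(ρσ³, η₁))` with `Z = 1 + η f_ex'` measurable (`measurable_deriv`).

References: BrezinaFeireisl2018 §3.1–3.2; measure theory only.
-/

noncomputable section

namespace Summit.AtomisticToContinuum.HydrodynamicLimit.Theorems.RES

open MeasureTheory Filter Set Function
open scoped Topology InnerProductSpace ENNReal
open Summit.AtomisticToContinuum.HydrodynamicLimit.Theses.BoxDissipativeWeakStrong
open Literature.MathematicalPhysics.KineticTheory Literature.Analysis.FluidPDE Literature.Analysis.FunctionSpaces
open Literature.Analysis.FluidPDE.CompressibleEuler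
open Literature.Analysis.FluidPDE.CompressibleEuler.EulerPhase
open Literature.Analysis.FluidPDE.CompressibleEuler.StrongPointData

/-- Box bounds along a good orbit: `|ρ̂| ≤ l⁻³`, `‖m̂‖ ≤ l⁻³ (1 + 2E(z))`, `|Ê| ≤ 2 E(z) l⁻³` for the box state of
`Φ_s z`, `z` good (kernel values in `[0, l⁻³]`, speeds bounded by the conserved energy). -/
theorem ia_box_bounds {σ : ℝ} {N : ℕ}
    (Φ : HardSphereFlow (Literature.Analysis.FluidPDE.Torus.geometry (Fin 3)) (hsDiameter σ N) (N + 1))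
    {l : ℝ} (hl : 0 < l) {z : Config (N + 1) (Fin 3) T3} (hz : z ∈ Φ.good) (s : ℝ) (x : T3) :
    |(boxState l (Φ.flow s z) x).1| ≤ (l ^ 3)⁻¹ ∧
      ‖(boxState l (Φ.flow s z) x).2.1‖ ≤ (l ^ 3)⁻¹ * (1 + 2 * configEnergy z) ∧
      |(boxState l (Φ.flow s z) x).2.2| ≤ 2 * configEnergy z * (l ^ 3)⁻¹ := by
  have h1 : |(boxState l (Φ.flow s z) x).1| ≤ (l ^ 3)⁻¹ := EABirthS1a.abs_density_le hl.le (Φ.flow s z) x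
  have h2 : ‖(boxState l (Φ.flow s z) x).2.1‖ ≤ (l ^ 3)⁻¹ * (1 + 2 * configEnergy (Φ.flow s z)) :=
    EABirthS1a.norm_momentum_le hl.le (Φ.flow s z) x
  rw [Φ.configEnergy_flow hz s] at h2
  obtain ⟨⟨hρ0, hρL⟩, -, hE0, hEV⟩ := FluxClosureB4.boxAtoms_bounds (Φ.flow s z) (χ := boxKernel l x)
    (kb := (l ^ 3)⁻¹) (Vb := Real.sqrt (∑ j, ‖(z j).2‖ ^ 2)) (LGFS.boxK_nonneg hl.le x) (LGFS.boxK_le hl.le x)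
    (FluxClosureB4.norm_vel_flow_le Φ hz s)
  have hsq : Real.sqrt (∑ j, ‖(z j).2‖ ^ 2) ^ 2 = 2 * configEnergy z := by
    rw [Real.sq_sqrt (Finset.sum_nonneg fun j _ => sq_nonneg _)]
    simp only [configEnergy]; ring
  refine ⟨h1, h2, ?_⟩
  rw [hsq] at hEV
  have hE2 : 0 ≤ 2 * configEnergy z := by rw [← hsq]; exact sq_nonneg _
  calc |(boxState l (Φ.flow s z) x).2.2| = (boxState l (Φ.flow s z) x).2.2 := abs_of_nonneg hE0
    _ ≤ 2 * configEnergy z * (boxState l (Φ.flow s z) x).1 := hEV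
    _ ≤ 2 * configEnergy z * (l ^ 3)⁻¹ := mul_le_mul_of_nonneg_left hρL hE2

/-- Sup bounds of the strong data read through the cut law on `[0,t] × 𝕋³` under `S`: one constant `B ≥ 0` bounds
`‖u‖`, `|μ_cut(ρ,θ)|`, `|θ|`, `|p_cut(ρ,θ)|` (coefficients of the smooth band extension along the solution). -/
theorem ia_strong_bounds {η₀ η₁ η₁B σ T : ℝ} {F χ f : ℝ → ℝ} {ρ θ : ℝ → T3 → ℝ} {u : ℝ → T3 → V3}
    (S : AnalyticOnNhd ℝ F (Ioo (-η₀) η₀) ∧ EqOn hsExcessFreeEnergy F (Ico 0 η₀) ∧ 0 < η₁ ∧ η₁ ≤ η₁B ∧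
      2 * η₁B < η₀ ∧ 0 < σ ∧
      (∀ x, 0 < x → x * σ ^ 3 ≤ η₁B → f x = hsExcessFreeEnergy (x * σ ^ 3) ∧ χ x = hsCompressibility (x * σ ^ 3)) ∧
      (EulerEOS.monatomicExcess χ f).IsGibbs ∧ IsHardSphereEulerSolution σ T ρ u θ ∧
      ∀ t ∈ Ico 0 T, ∀ x, ρ t x * σ ^ 3 ≤ η₁ / 2)
    {t : ℝ} (ht : t ∈ Ico 0 T) :
    ∃ B : ℝ, 0 ≤ B ∧ ∀ s ∈ Icc 0 t, ∀ x : T3, ‖u s x‖ ≤ B ∧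
      |(cutEOS σ η₁).chemPotential (ρ s x) (θ s x)| ≤ B ∧ |θ s x| ≤ B ∧ |(cutEOS σ η₁).p (ρ s x) (θ s x)| ≤ B := by
  have hB : IsClassicalEulerSolution (EulerEOS.monatomicExcess χ f) T ρ u θ := sx_sol_B S
  have hGB : (EulerEOS.monatomicExcess χ f).IsGibbs := S.2.2.2.2.2.2.2.1
  have hIcc : Icc 0 t ⊆ Ico 0 T := fun s hs => ⟨hs.1, hs.2.trans_lt ht.2⟩
  obtain ⟨M, hM0, hBM⟩ := hB.exists_bound_pointData ht.2
  obtain ⟨Np, hNp⟩ := hB.exists_coeffBound hGB ht.1 ht.2 hM0 hBM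
  obtain ⟨Bu, hBu⟩ := hB.smooth_velocity.exists_norm_le_of_isCompact isCompact_Icc hIcc
  obtain ⟨x₀⟩ := (inferInstance : Nonempty T3)
  have hNp0 : 0 ≤ Np := (abs_nonneg _).trans (hNp 0 ⟨le_rfl, ht.1⟩ x₀).2.1
  refine ⟨Np + Bu ^ 2 / 2 + |Bu|, by positivity, fun s hs x => ?_⟩
  obtain ⟨hφ, hp, hΘ, -⟩ := hNp s hs x
  obtain ⟨hpc, -, -, -, hμc, -⟩ := (sx_pd_transfer S) (hIcc hs) x
  have hu : ‖u s x‖ ≤ Bu := hBu s hs x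
  have hu2 : ‖u s x‖ ^ 2 ≤ Bu ^ 2 := pow_le_pow_left₀ (norm_nonneg _) hu 2
  refine ⟨hu.trans ((le_abs_self Bu).trans (by nlinarith [sq_nonneg Bu])), ?_, ?_, ?_⟩
  · have h1 : (cutEOS σ η₁).chemPotential (ρ s x) (θ s x) =
        (EulerEOS.monatomicExcess χ f).chemPotential (ρ s x) (θ s x) := hμc
    have h2 : |‖u s x‖ ^ 2 / 2 - (EulerEOS.monatomicExcess χ f).chemPotential (ρ s x) (θ s x)| ≤ Np := hφ
    rw [h1]
    have h3 := abs_le.1 h2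
    rw [abs_le]
    constructor <;> nlinarith [abs_nonneg Bu, sq_nonneg ‖u s x‖]
  · have h2 : |θ s x| ≤ Np := hΘ
    exact h2.trans (by nlinarith [abs_nonneg Bu, sq_nonneg Bu])
  · have h1 : (cutEOS σ η₁).p (ρ s x) (θ s x) = (EulerEOS.monatomicExcess χ f).p (ρ s x) (θ s x) := hpc
    have h2 : |(EulerEOS.monatomicExcess χ f).p (ρ s x) (θ s x)| ≤ Np := hp
    rw [h1]
    exact h2.trans (by nlinarith [abs_nonneg Bu, sq_nonneg Bu])

/-- **(A2) `sx_integrableOn_obs`** (corrected signature: the strong-side conjunction `S` replaces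
`hcont, hσ, hη₁, hη₁₀, hsol`). Time-integrability on `(0,t]` and linear-in-energy domination on `[0,t]` of the clamped
box relative-energy observable along every good orbit. -/
theorem sx_integrableOn_obs {η₀ η₁ η₁B σ T : ℝ} {F χ f : ℝ → ℝ} {ρ θ : ℝ → T3 → ℝ} {u : ℝ → T3 → V3}
    (S : AnalyticOnNhd ℝ F (Ioo (-η₀) η₀) ∧ EqOn hsExcessFreeEnergy F (Ico 0 η₀) ∧ 0 < η₁ ∧ η₁ ≤ η₁B ∧
      2 * η₁B < η₀ ∧ 0 < σ ∧
      (∀ x, 0 < x → x * σ ^ 3 ≤ η₁B → f x = hsExcessFreeEnergy (x * σ ^ 3) ∧ χ x = hsCompressibility (x * σ ^ 3)) ∧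
      (EulerEOS.monatomicExcess χ f).IsGibbs ∧ IsHardSphereEulerSolution σ T ρ u θ ∧
      ∀ t ∈ Ico 0 T, ∀ x, ρ t x * σ ^ 3 ≤ η₁ / 2)
    {N : ℕ} (Φ : HardSphereFlow (Literature.Analysis.FluidPDE.Torus.geometry (Fin 3)) (hsDiameter σ N) (N + 1))
    {l : ℝ} (hl : 0 < l) {a b : ℝ} (hab : a ≤ b) {t : ℝ} (ht : t ∈ Ico 0 T) :
    ∃ A B : ℝ, ∀ z ∈ Φ.good,
      IntegrableOn (fun s => clampedRelEnergyObs σ η₁ a b ρ u θ N Φ l s z) (Ioc 0 t) ∧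
        ∀ s ∈ Icc 0 t, |clampedRelEnergyObs σ η₁ a b ρ u θ N Φ l s z| ≤ A + B * configEnergy z := by
  have hsol : IsHardSphereEulerSolution σ T ρ u θ := S.2.2.2.2.2.2.2.2.1
  have hη₁ : 0 < η₁ := S.2.2.1
  have hσ : 0 < σ := S.2.2.2.2.2.1
  have hη₁₀ : η₁ < η₀ := sx_band_lt S
  have hη₀ : 0 < η₀ := hη₁.trans hη₁₀
  have hcont : ContinuousOn hsExcessFreeEnergy (Ico 0 η₀) :=
    (S.1.continuousOn.mono fun η hη => ⟨(neg_lt_zero.2 hη₀).trans_le hη.1, hη.2⟩).congr S.2.1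
  have hIcc : Icc 0 t ⊆ Ico 0 T := fun s hs => ⟨hs.1, hs.2.trans_lt ht.2⟩
  have hcl : ∀ s : ℝ, max 0 (min s t) ∈ Icc 0 t := fun s => ⟨le_max_left _ _, max_le ht.1 (min_le_right _ _)⟩
  -- the constants
  obtain ⟨B, hB0, hB⟩ := ia_strong_bounds S ht
  set C : ℝ := 1 + 5 * B + B ^ 2 + B * max |a| |b| with hC
  have hC0 : 0 ≤ C := by
    have : 0 ≤ max |a| |b| := le_max_of_le_left (abs_nonneg a)
    rw [hC]; positivity
  refine ⟨C * (1 + 2 * (l ^ 3)⁻¹), 4 * C * (l ^ 3)⁻¹, fun z hz => ?_⟩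
  -- the pointwise bound along the orbit
  have hpt : ∀ s ∈ Icc 0 t, ∀ x : T3,
      |clampedRelEnergy σ η₁ a b (ρ s x) (u s x) (θ s x) (boxState l (Φ.flow s z) x)| ≤
        C * (1 + 2 * (l ^ 3)⁻¹) + 4 * C * (l ^ 3)⁻¹ * configEnergy z := by
    intro s hs x
    obtain ⟨hu, hμ, hΘ, hp⟩ := hB s hs x
    obtain ⟨h1, h2, h3⟩ := ia_box_bounds Φ hl hz s x
    refine (tz_abs_clampedRelEnergy_le hab hB0 hu hμ hΘ hp _).trans ?_
    rw [← hC]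
    have hsum : 1 + |(boxState l (Φ.flow s z) x).1| + ‖(boxState l (Φ.flow s z) x).2.1‖ +
        |(boxState l (Φ.flow s z) x).2.2| ≤ 1 + 2 * (l ^ 3)⁻¹ + 4 * (l ^ 3)⁻¹ * configEnergy z := by
      nlinarith
    calc C * (1 + |(boxState l (Φ.flow s z) x).1| + ‖(boxState l (Φ.flow s z) x).2.1‖ +
          |(boxState l (Φ.flow s z) x).2.2|) ≤ C * (1 + 2 * (l ^ 3)⁻¹ + 4 * (l ^ 3)⁻¹ * configEnergy z) :=
        mul_le_mul_of_nonneg_left hsum hC0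
      _ = _ := by ring
  refine ⟨?_, fun s hs => ?_⟩
  · -- integrability on `(0, t]`: jointly measurable at the clamped time + bounded
    have hγ : Measurable fun s : ℝ => Φ.flow s z :=
      Φ.measurable_flow_prod_torus.comp ((measurable_const (a := (⟨z, hz⟩ : Φ.good))).prodMk measurable_id)
    have hc : Measurable fun p : ℝ × T3 => max 0 (min p.1 t) :=
      measurable_const.max (measurable_fst.min measurable_const)
    have hwx : Measurable fun p : ℝ × T3 => (Φ.flow (max 0 (min p.1 t)) z, p.2) :=
      (hγ.comp hc).prodMk measurable_snd
    have hR := (LGFS.measurable_empiricalDensityField_param (n := N + 1) (k := boxKernel l)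
      (LGFS.measurable_boxK_uncurry l)).comp hwx
    have hM := (LGFS.measurable_empiricalMomentumField_param (n := N + 1) (k := boxKernel l)
      (LGFS.measurable_boxK_uncurry l)).comp hwx
    have hE := (LGFS.measurable_empiricalEnergyField_param (n := N + 1) (k := boxKernel l)
      (LGFS.measurable_boxK_uncurry l)).comp hwx
    have hG := (EABirthS1a.measurable_statEntropy (N := N) hcont hσ.le hη₁.le hη₁₀ hl.le a b).comp hwx
    have hu' : Measurable fun q : ℝ × T3 => u (max 0 (min q.1 t)) q.2 :=
      EABirthS1a.measurable_clampTime hsol.smooth_velocity.continuousOn_stLift ht.1 hIcc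
    have hθ' : Measurable fun q : ℝ × T3 => θ (max 0 (min q.1 t)) q.2 :=
      EABirthS1a.measurable_clampTime hsol.smooth_temperature.continuousOn_stLift ht.1 hIcc
    have hρ' : Measurable fun q : ℝ × T3 => ρ (max 0 (min q.1 t)) q.2 :=
      EABirthS1a.measurable_clampTime hsol.smooth_density.continuousOn_stLift ht.1 hIcc
    have hφ' : Measurable fun q : ℝ × T3 => energyTestFunction (cutEOS σ η₁) ρ u θ (max 0 (min q.1 t)) q.2 :=
      EABirthS1a.measurable_clampTime (sx_energyTest_smooth S).continuousOn_stLift ht.1 hIcc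
    have mhs : Measurable hsCompressibility := measurable_const.add (measurable_id.mul (measurable_deriv _))
    have hp' : Measurable fun q : ℝ × T3 =>
        (cutEOS σ η₁).p (ρ (max 0 (min q.1 t)) q.2) (θ (max 0 (min q.1 t)) q.2) := by
      simp only [tz_p_eq, cutCompressibility]
      exact (hρ'.mul hθ').mul (mhs.comp ((hρ'.mul_const _).min measurable_const))
    have hGm : Measurable fun p : ℝ × T3 => clampedRelEnergy σ η₁ a b (ρ (max 0 (min p.1 t)) p.2)
        (u (max 0 (min p.1 t)) p.2) (θ (max 0 (min p.1 t)) p.2) (boxState l (Φ.flow (max 0 (min p.1 t)) z) p.2) := by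
      simp only [sx_clampedRelEnergy_box]
      have hSt : Measurable fun p : ℝ × T3 => (boxState l (Φ.flow (max 0 (min p.1 t)) z) p.2).1 *
          EABirthS1a.statEntropy σ η₁ l a b (Φ.flow (max 0 (min p.1 t)) z) p.2 := hR.mul hG
      exact (((hE.sub (hM.inner hu')).add (hR.mul hφ')).sub (hθ'.mul hSt)).add hp'
    show IntegrableOn (fun s => ∫ x, clampedRelEnergy σ η₁ a b (ρ s x) (u s x) (θ s x)
      (boxState l (Φ.flow s z) x)) (Ioc 0 t)
    refine ia_integrableOn_Ioc_integral (C := C * (1 + 2 * (l ^ 3)⁻¹) + 4 * C * (l ^ 3)⁻¹ * configEnergy z) hGm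
      (fun s hs x => ?_) (fun p _ => hpt _ (hcl p.1) p.2)
    simp only [min_eq_left hs.2, max_eq_right hs.1.le]
  · -- the bound on `[0, t]`
    have h := norm_integral_le_of_norm_le_const (μ := (volume : Measure T3))
      (f := fun x => clampedRelEnergy σ η₁ a b (ρ s x) (u s x) (θ s x) (boxState l (Φ.flow s z) x))
      (C := C * (1 + 2 * (l ^ 3)⁻¹) + 4 * C * (l ^ 3)⁻¹ * configEnergy z)
      (ae_of_all _ fun x => by rw [Real.norm_eq_abs]; exact hpt s hs x)
    rw [probReal_univ, mul_one, Real.norm_eq_abs] at h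
    exact h

end Summit.AtomisticToContinuum.HydrodynamicLimit.Theorems.RES

end
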